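import Mathlib
import Literature.Computability.AlgebraicComplexity.PermanentUniversality
import Literature.Computability.AlgebraicComplexity.VNPeEqVNP
import Literature.Computability.AlgebraicComplexity.OrbitClosureProofs
import Literature.Computability.AlgebraicComplexity.OrbitCoordinateRing
import HarnessLib

/-!
# `ValuativeGCT.ValuativeFlip` (stmt-ValiantsHypothesis-12624): uniform permanental representations of
# forms and the homogenisation of affine permanental representations with a padding variable

Crux `ValuativeFlip` of route `ValuativeGCT` (wall-breaker decomposition k9/16, axis "explicit
padded-permanent highest-weight vectors for seedRichness", seat 3, 2026-08-16).  Preliminaries of the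
padded-permanent plethysm inheritance (`…PerUniversalPlethysm.lean`): the two ingredients that make the
padded permanent `X₀₀^{m-N} per_N` UNIVERSAL for padded forms `X_top^{m-k} · f`, `f` any form of degree
`k` in `k²` variables, with `N` depending on `k` only.

* `exists_arithExpr_eval_eq_of_mem_homogeneousSubmodule` — every `p ∈ ℂ[x_σ]_k` has an arithmetic
  expression (formula) of size EXACTLY `#degMonomials(σ, k) · (k + #σ + 2)`, uniform in `p`
  (the monomial formula `∑_{|d| = k} coeff_d(p) · ∏_i X_i^{d_i}` over ALL degree-`k` exponents);
* `exists_entryPer_eq_of_mem_homogeneousSubmodule` — hence, by Valiant's universality of the permanent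
  in the BCS form (`BCS1997_thm_21_27_holds`: a formula of size `u` is the permanent of a `(2u+2)²` matrix
  of constants and variables), `p = per A` with `A` of the uniform size
  `N₀(σ, k) = 2 · #degMonomials(σ, k) · (k + #σ + 2) + 2`;
* `exists_linSubst_paddedPer_eq` — the permanent twin of Mulmuley–Sohoni's homogenisation Prop. 4.4
  (tree: `X_pow_mul_rename_mem_endOrbit_detPoly`) WITH a padding variable: if `q = per A`, `A` an
  `n × n` matrix of affine linear forms, `deg q = s ≤ #n`, then for any placement `κ : n × n ↪ σ'` of the
  generic permanent, any padding variable `z ∉ κ(n × n)`, any target variable `y` and placement `ι` of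
  the variables of `q`, some linear substitution maps `X_z^a · per_n(X_κ)` to `X_y^{a + #n - s} · q(X_ι)`
  (substitute `X_z ↦ X_y`, `X_{κ(i,j)} ↦ a₀ X_y + ∑_t a_t X_{ι t}`; both sides agree where `X_y ≠ 0`).

Sources: L. G. Valiant, *Completeness classes in algebra*, STOC 1979, §2; P. Bürgisser, M. Clausen,
M. A. Shokrollahi, *Algebraic Complexity Theory* (1997) Thm. (21.27); K. Mulmuley, M. Sohoni,
SIAM J. Comput. 31 (2001) Prop. 4.4.
-/

-- `Summit.ValiantsHypothesis.ValiantsHypothesis.…` is the tree's mandated single-conjunct layout (Sub = Summit).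
set_option linter.dupNamespace false

namespace Summit.ValiantsHypothesis.ValiantsHypothesis.Theorems.ValuativeFlip

open MvPolynomial
open scoped BigOperators
open Literature.Computability.AlgebraicComplexity

noncomputable section

/-- **Every polynomial supported in degree `m` has an arithmetic expression of a size depending
only on `(σ, m)`**: `p = ∑_{|d| = m} coeff_d(p) · ∏_i X_i^{d_i}` written out as a formula has size
`#degMonomials(σ, m) · (m + #σ + 2)`. [folklore; BCS 1997 (21.19)] -/
theorem exists_arithExpr_eval_eq_of_mem_homogeneousSubmodule {σ : Type*} [Fintype σ] [DecidableEq σ]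
    (m : ℕ) (p : MvPolynomial σ ℂ) (hp : p ∈ homogeneousSubmodule σ ℂ m) :
    ∃ φ : ArithExpr ℂ σ, φ.eval = p ∧ φ.size = (degMonomials σ m).card * (m + Fintype.card σ + 2) := by
  classical
  -- the monomial `x^d` as a product of `#σ` powers, each power a product of `d i` copies of `X_i`
  let mono : (σ →₀ ℕ) → ArithExpr ℂ σ := fun d =>
    ArithExpr.listProd ((Finset.univ : Finset σ).toList.map fun i =>
      ArithExpr.listProd (List.replicate (d i) (ArithExpr.var i)))
  have hmono_eval : ∀ d : σ →₀ ℕ, (mono d).eval = monomial d 1 := by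
    intro d
    simp only [mono, ArithExpr.eval_listProd, List.map_map]
    have h1 : ((Finset.univ : Finset σ).toList.map
        (ArithExpr.eval ∘ fun i => ArithExpr.listProd (List.replicate (d i) (ArithExpr.var (k := ℂ) i)))) =
        (Finset.univ : Finset σ).toList.map (fun i => (X i : MvPolynomial σ ℂ) ^ (d i)) := by
      refine List.map_congr_left fun i _ => ?_
      simp [ArithExpr.eval_listProd, List.map_replicate, List.prod_replicate]
    rw [h1, Finset.prod_map_toList, MvPolynomial.monomial_eq, C_1, one_mul,
      Finsupp.prod_fintype _ _ (fun i => by simp)]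
  have hmono_size : ∀ d : σ →₀ ℕ, d ∈ degMonomials σ m → (mono d).size = m + Fintype.card σ := by
    intro d hd
    simp only [mono, ArithExpr.size_listProd, List.map_map, List.length_map, Finset.length_toList,
      Finset.card_univ]
    have h1 : ((Finset.univ : Finset σ).toList.map
        (ArithExpr.size ∘ fun i => ArithExpr.listProd (List.replicate (d i) (ArithExpr.var (k := ℂ) i)))) =
        (Finset.univ : Finset σ).toList.map (fun i => d i) := by
      refine List.map_congr_left fun i _ => ?_
      simp [ArithExpr.size_listProd, List.map_replicate, List.sum_replicate]
    rw [h1, Finset.sum_map_toList]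
    have hdeg : ∑ i ∈ d.support, d i = m := by
      have := mem_degMonomials_iff.mp hd
      simpa [Finsupp.degree] using this
    rw [← Finset.sum_subset (Finset.subset_univ d.support) (fun i _ hi => by simpa using hi), hdeg]
  refine ⟨ArithExpr.fsum (degMonomials σ m) fun d =>
      ArithExpr.mul (ArithExpr.const (coeff d p)) (mono d), ?_, ?_⟩
  · simp only [ArithExpr.eval_fsum, ArithExpr.eval_mul, ArithExpr.eval_const, hmono_eval,
      C_mul_monomial, mul_one]
    have hsupp : p.support ⊆ degMonomials σ m := by
      intro d hd
      rw [mem_degMonomials_iff]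
      have := (mem_homogeneousSubmodule m p).mp hp (mem_support_iff.mp hd)
      simpa [Finsupp.degree, Finsupp.weight_apply, Finsupp.sum] using this
    rw [← Finset.sum_subset hsupp (fun d _ hd => by
      rw [notMem_support_iff.mp hd, monomial_zero])]
    exact (p.as_sum).symm
  · rw [ArithExpr.size_fsum]
    have h1 : ∑ d ∈ degMonomials σ m, (ArithExpr.mul (ArithExpr.const (coeff d p)) (mono d)).size =
        ∑ d ∈ degMonomials σ m, (m + Fintype.card σ + 1) := by
      refine Finset.sum_congr rfl fun d hd => ?_
      rw [ArithExpr.size_mul, ArithExpr.size_const, hmono_size d hd]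
      ring
    rw [h1, Finset.sum_const, smul_eq_mul]
    ring

/-- **Uniform affine permanental representations of forms** (Valiant 1979 universality of the
permanent, in the size bound of BCS 1997 Thm. (21.27)): every `p ∈ k[x_σ]_m` is the permanent of an
`N₀ × N₀` matrix of constants and variables with `N₀ = 2 · #degMonomials(σ, m) · (m + #σ + 2) + 2`
depending only on `(σ, m)`. [BCS 1997 Thm. (21.27); Valiant 1979 §2] -/
theorem exists_entryPer_eq_of_mem_homogeneousSubmodule {σ : Type} [Fintype σ] [DecidableEq σ]
    (m : ℕ) (p : MvPolynomial σ ℂ) (hp : p ∈ homogeneousSubmodule σ ℂ m) :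
    ∃ A : Matrix (Fin (2 * ((degMonomials σ m).card * (m + Fintype.card σ + 2)) + 2))
        (Fin (2 * ((degMonomials σ m).card * (m + Fintype.card σ + 2)) + 2)) (ℂ ⊕ σ),
      entryPer A = p := by
  obtain ⟨φ, hφ, hsize⟩ := exists_arithExpr_eval_eq_of_mem_homogeneousSubmodule m p hp
  obtain ⟨A, -, hA⟩ := BCS1997_thm_21_27_holds ℂ φ
  rw [hφ] at hA
  rw [← hsize]
  exact ⟨A, hA⟩


/-- **Homogenised affine permanental representations are instances of the PADDED permanent**
(permanent twin of Mulmuley–Sohoni's Prop. 4.4 / the tree's `X_pow_mul_rename_mem_endOrbit_detPoly`,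
with an extra padding variable).  Let `q` be a form of degree `s ≤ #n` with an affine permanental
representation `q = per A`, `A` an `n × n` matrix of affine linear forms in the variables `τ`.  Place
the generic `n × n` permanent on the variables `κ : n × n ↪ σ'` and pad it by a variable `X_z` off the
block.  Then the substitution `X_z ↦ X_y`, `X_{κ(i,j)} ↦ a₀ X_y + ∑_t a_t X_{ι t}` (homogenising the
entry `A i j = a₀ + ∑_t a_t x_t` with `X_y` and placing `x_t` at `ι t`) maps `X_z^a · per_n(X_κ)` to
`X_y^{a + (#n - s)} · q(X_ι)`: both sides agree wherever `X_y ≠ 0` (pull `X_y` out of every row and use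
the homogeneity of `q`), hence everywhere.
[Mulmuley–Sohoni 2001 Prop. 4.4 (for `det`); Valiant 1979 §2; folklore] -/
theorem exists_linSubst_paddedPer_eq {k : Type*} [Field k] [Infinite k]
    {τ : Type*} [Fintype τ] [DecidableEq τ] {n : Type*} [Fintype n] [DecidableEq n]
    {σ' : Type*} [Fintype σ'] [DecidableEq σ']
    {q : MvPolynomial τ k} {s : ℕ} (hq : q.IsHomogeneous s) (hsn : s ≤ Fintype.card n)
    (A : Matrix n n (MvPolynomial τ k)) (hAdeg : ∀ i j, (A i j).totalDegree ≤ 1)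
    (hAper : A.permanent = q) (κ : n × n → σ') (hκ : Function.Injective κ) (z y : σ')
    (hz : z ∉ Set.range κ) (ι : τ → σ') (a : ℕ) :
    ∃ M : Matrix σ' σ' k, linSubst σ' k M (X z ^ a * rename κ (perPoly n k)) =
      X y ^ (a + (Fintype.card n - s)) * rename ι q := by
  classical
  have hz' : ∀ p, z ≠ κ p := fun p h => hz ⟨p, h.symm⟩
  have hz'' : ∀ p, κ p ≠ z := fun p h => hz ⟨p, h⟩
  -- the homogenised entries, column by column
  set F : σ' → n × n → k := fun l p =>
    (if l = y then coeff 0 (A p.1 p.2) else 0) +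
      ∑ t, if l = ι t then coeff (Finsupp.single t 1) (A p.1 p.2) else 0 with hF
  set M : Matrix σ' σ' k := fun l v =>
    (if v = z then (if l = y then (1 : k) else 0) else 0) + ∑ p, if v = κ p then F l p else 0 with hM
  refine ⟨M, ?_⟩
  have hMz : ∀ l, M l z = if l = y then 1 else 0 := by
    intro l
    simp [hM, hz']
  have hMκ : ∀ l p, M l (κ p) = F l p := by
    intro l p
    simp only [hM, hz'' p, if_false, zero_add, hκ.eq_iff]
    rw [Finset.sum_ite_eq Finset.univ p, if_pos (Finset.mem_univ _)]
  -- the padding column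
  have hcolz : ∀ x : σ' → k, eval x (linSubst σ' k M (X z)) = x y := by
    intro x
    rw [linSubst_X, map_sum]
    simp only [smul_eval, eval_X, hMz, ite_mul, one_mul, zero_mul]
    rw [Finset.sum_ite_eq' Finset.univ y, if_pos (Finset.mem_univ _)]
  -- the block columns, where `x y ≠ 0`
  have hentry : ∀ x : σ' → k, x y ≠ 0 → ∀ p : n × n,
      eval x (linSubst σ' k M (X (κ p))) = x y * eval (fun t => x (ι t) / x y) (A p.1 p.2) := by
    intro x hx p
    rw [linSubst_X, map_sum, eval_eq_of_totalDegree_le_one (hAdeg p.1 p.2)]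
    simp only [smul_eval, eval_X, hMκ, hF, add_mul, Finset.sum_add_distrib, Finset.sum_mul, ite_mul,
      zero_mul]
    rw [Finset.sum_comm]
    simp only [mul_add, Finset.mul_sum]
    congr 1
    · rw [Finset.sum_ite_eq' Finset.univ y, if_pos (Finset.mem_univ _)]
      ring
    · refine Finset.sum_congr rfl fun t _ => ?_
      rw [Finset.sum_ite_eq' Finset.univ (ι t), if_pos (Finset.mem_univ _)]
      field_simp
  -- the substituted permanent, where `x y ≠ 0`
  have hper : ∀ x : σ' → k, x y ≠ 0 →
      eval x (linSubst σ' k M (rename κ (perPoly n k))) =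
        x y ^ Fintype.card n * eval (fun t => x (ι t) / x y) q := by
    intro x hx
    set φ : MvPolynomial (n × n) k →+* MvPolynomial σ' k :=
      (linSubst σ' k M).toRingHom.comp (rename κ).toRingHom with hφ
    have hmat : ((Matrix.mvPolynomialX n n k).map φ).map (eval x) =
        x y • A.map (eval fun t => x (ι t) / x y) := by
      ext i j
      simp only [Matrix.map_apply, Matrix.mvPolynomialX_apply, Matrix.smul_apply, smul_eq_mul, hφ,
        RingHom.coe_comp, Function.comp_apply, AlgHom.toRingHom_eq_coe, RingHom.coe_coe, rename_X]
      exact hentry x hx (i, j)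
    have h1 : linSubst σ' k M (rename κ (perPoly n k)) = ((Matrix.mvPolynomialX n n k).map φ).permanent := by
      rw [perPoly, Matrix.permanent_map_ringHom]
      rfl
    rw [h1, ← Matrix.permanent_map_ringHom (eval x), hmat, Matrix.permanent_smul,
      Matrix.permanent_map_ringHom, hAper]
  -- both sides agree where `x y ≠ 0`
  have hlhs : ∀ x : σ' → k, x y ≠ 0 →
      eval x (linSubst σ' k M (X z ^ a * rename κ (perPoly n k))) =
        x y ^ (a + (Fintype.card n - s)) * eval (x ∘ ι) q := by
    intro x hx
    rw [map_mul, map_pow, map_mul, map_pow, hcolz x, hper x hx]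
    have hscale : (fun t => x (ι t) / x y) = (x y)⁻¹ • (x ∘ ι) := by
      funext t
      simp [div_eq_inv_mul]
    rw [hscale, eval_smul_of_isHomogeneous hq]
    obtain ⟨c, hc⟩ := Nat.exists_eq_add_of_le hsn
    rw [hc, Nat.add_sub_cancel_left, pow_add, pow_add]
    have hxs : x y ^ s * (x y)⁻¹ ^ s = 1 := by
      rw [← mul_pow, mul_inv_cancel₀ hx, one_pow]
    calc x y ^ a * (x y ^ s * x y ^ c * ((x y)⁻¹ ^ s * eval (x ∘ ι) q))
        = x y ^ a * x y ^ c * (x y ^ s * (x y)⁻¹ ^ s) * eval (x ∘ ι) q := by ring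
      _ = x y ^ a * x y ^ c * eval (x ∘ ι) q := by rw [hxs, mul_one]
  have hprod : (linSubst σ' k M (X z ^ a * rename κ (perPoly n k)) -
      X y ^ (a + (Fintype.card n - s)) * rename ι q) * X y = 0 := by
    apply MvPolynomial.funext
    intro x
    rw [map_mul, map_sub, map_zero, eval_X]
    by_cases hx : x y = 0
    · rw [hx, mul_zero]
    · rw [hlhs x hx, map_mul, map_pow, eval_X, eval_rename, sub_self, zero_mul]
  have hX : (X y : MvPolynomial σ' k) ≠ 0 := X_ne_zero y
  exact sub_eq_zero.mp ((mul_eq_zero.mp hprod).resolve_right hX)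


end

end Summit.ValiantsHypothesis.ValiantsHypothesis.Theorems.ValuativeFlip
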